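import Summits.BirchSwinnertonDyer.BirchSwinnertonDyer.Theorems.PrintCf2RamifiedOffTYZHalfMover
import HarnessLib

/-!
# Route `PrintCf2`, crux stmt-BirchSwinnertonDyer-20509 `RamifiedOffTYZOfFacts` — WHERE THE SQUARE-MOVERS LIVE WHEN `𝓛(n)` IS ODD: inside
# `Gal(ℍ′_n/K_n(i))` a square `g²` moves the genus point iff `g` moves the half-generator, so **square-movers in the stabiliser of `i, √−n` exist
# iff `ρ(n) = 1`** (a falsifiable statement on Tian–Yuan–Zhang's odd-`𝓛` families)
# (cell `bsd-print-cf2`, LEAD of 20509 g11, line `offtyz-v7`, lineage cycle 12, corollary file of `…LowerHalfDoor` / `…HalfMover`; fact-free, Theses-free, no `def`)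

HONEST FRAMING (crux 20509, DECIDING, OPEN AS A CLASS): bookkeeping on Thm 3.5's displayed main clause and Lemma 3.18 (hypotheses on
`D : GenusPointData n`), this seat's identity `𝓛(n) odd ⟹ g²·P(n) − P(n) = g·Q₁ − Q₁` (`…LowerHalfDoor`, p727254), the half-mover existence
(`…HalfMover`, p728706) and the `ρ = 0` freeze (`…GenusCharacterRho`, p726885).  Nothing is asserted; C⁺ stays open.  The point of this file is a
PREDICTION the displays + BSD₂ make about the `s = 1` families where TYZ prove `𝓛(n)` odd: the movers of g4–g9 (squares `g²` moving `P(n)`) that lie in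
the stabiliser of `i` and `√−n` exist EXACTLY when the generator's abscissa is outside `{±1, ±n}·ℚ^{×2}` — testable per `n` by an instrument.

* `exists_sq_mover_iff_exists_halfMover_of_odd_scriptL`: square-free odd `n`, `rank ≤ 1`, `𝓛(n)` odd, Thm 3.5, Lemma 3.18, `R`/`Q₁` as usual:
  (∃ `g` fixing `i`, `√−n` with `g²·P(n) ≠ P(n)`) ⟺ (∃ `g` fixing `i`, `√−n` with `g·Q₁ ≠ Q₁`).
* `exists_sq_mover_of_odd_scriptL_of_x_not_mem`: … and `x(R) ∉ {±1, ±n}·ℚ^{×2}` ⟹ a square-mover exists in the stabiliser.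
* `galPt_sq_genusPoint_eq_of_odd_scriptL_of_rhoIndex_eq_one`: … and `ρ(n) = 0` ⟹ NO square of the stabiliser moves `P(n)` (so TYZ's mover, which exists
  at `s = 1` for `n ≡ 5 (8)` by g7's assembly, must then flip `i` — as it does at `n = 5`: `Cl′₅ ≅ ℤ/4 = ⟨σ_ϖ⟩`, `σ_ϖ(i) = −i`, `ρ(5) = 0` since
  `x(R) = −4`).
Beyond-print theorem: NO (corollaries).  BSD is not proved by any of this; no class is closed by this file.

References: [cite: TianYuanZhang2017, Thm. 3.5 (p0011 L94–L100), Lemma 3.18 (p0017 L152–L153), §1 (p0002 L101–L110), Prop. 3.2 (1), Thm. 3.6 (1)];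
[cite: SilvermanAEC2009, X.4.9]; tree: `…LowerHalfDoor`, `…HalfMover`, `…GenusCharacterRho`.
-/

noncomputable section

open scoped Classical

open WeierstrassCurve WeierstrassCurve.Affine Literature.NumberTheory.EllipticCurves
  Literature.NumberTheory.EllipticCurves.Rank1Residual Summit.BirchSwinnertonDyer.Rank1Residual
  Literature.NumberTheory.EllipticCurves.TianYuanZhang2017
  Literature.NumberTheory.EllipticCurves.TianYuanZhang2017.W2
  Summit.BirchSwinnertonDyer.PrintCf2.LevelTwoHalfGenerator
  Summit.BirchSwinnertonDyer.PrintCf2.GaloisMotion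
  Summit.BirchSwinnertonDyer.PrintCf2.GenusCharacter
  Summit.BirchSwinnertonDyer.PrintCf2.GenusCharacterRho
  Summit.BirchSwinnertonDyer.PrintCf2.LowerHalfDoor
  Summit.BirchSwinnertonDyer.PrintCf2.HalfMover

set_option autoImplicit false

namespace Summit.BirchSwinnertonDyer.PrintCf2.SquareMoverRho

variable {n : ℕ}

/-- **WHEN `𝓛(n)` IS ODD, SQUARE-MOVERS AND HALF-MOVERS IN THE STABILISER OF `i, √−n` ARE THE SAME ELEMENTS**: square-free odd `n`, `rank E_n(ℚ) ≤ 1`,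
`𝓛(n)` odd, Thm 3.5's displayed main clause, Lemma 3.18; `R` a generator of `E_n(ℚ)` mod torsion, `Q₁` a half of its twist.  For `g` fixing `i` and
`√−n`: `g²·P(n) ≠ P(n) ⟺ g·Q₁ ≠ Q₁`. [cite: TianYuanZhang2017, Thm. 3.5 (p0011 L94–L100), Lemma 3.18 (p0017 L152–L153)] -/
theorem galPt_sq_genusPoint_ne_iff_galPt_half_ne_of_odd_scriptL (hsq : Squarefree n) [(congruentNumberCurve n).IsElliptic]
    (hodd : Odd n) (hr1 : (congruentNumberCurve n).mordellWeilRank ≤ 1) (D : GenusPointData n) (h35 : D.thm35Main)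
    (h318 : D.lemma318) (hLodd : Odd (D.scriptL n))
    {R : (congruentNumberCurve n).toAffine.Point} (hR : ∀ x, ∃ k : ℤ, IsOfFinAddOrder (x - k • R))
    {Q₁ : APoint D.H} (hQ₁ : φH D Q₁ = Point.map (W' := curveA.twoIsogenyCodomain)
      (D.embK n (Nat.mem_divisors_self n hsq.ne_zero)) (ΘE hsq.ne_zero R))
    (g : D.H ≃ₐ[ℚ] D.H) (hgi : g D.im = D.im) (hgK : g (D.sqrtNeg n) = D.sqrtNeg n) :
    D.galPt (g * g) (D.P n) ≠ D.P n ↔ D.galPt g Q₁ ≠ Q₁ := by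
  have h := galPt_sq_genusPoint_sub_eq_galPt_half_sub_of_odd_scriptL hsq hodd hr1 D h35 h318 hLodd hR hQ₁ g hgi hgK
  constructor
  · intro hne hQ
    apply hne
    rw [hQ, sub_self, sub_eq_zero] at h
    exact h
  · intro hne hP
    apply hne
    rw [hP, sub_self] at h
    exact (sub_eq_zero.mp h.symm)

/-- **Existential form**: when `𝓛(n)` is odd, a square-mover in the stabiliser of `i, √−n` exists iff a half-mover does.
[cite: TianYuanZhang2017, Thm. 3.5 (p0011 L94–L100), Lemma 3.18 (p0017 L152–L153)] -/
theorem exists_sq_mover_iff_exists_halfMover_of_odd_scriptL (hsq : Squarefree n) [(congruentNumberCurve n).IsElliptic]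
    (hodd : Odd n) (hr1 : (congruentNumberCurve n).mordellWeilRank ≤ 1) (D : GenusPointData n) (h35 : D.thm35Main)
    (h318 : D.lemma318) (hLodd : Odd (D.scriptL n))
    {R : (congruentNumberCurve n).toAffine.Point} (hR : ∀ x, ∃ k : ℤ, IsOfFinAddOrder (x - k • R))
    {Q₁ : APoint D.H} (hQ₁ : φH D Q₁ = Point.map (W' := curveA.twoIsogenyCodomain)
      (D.embK n (Nat.mem_divisors_self n hsq.ne_zero)) (ΘE hsq.ne_zero R)) :
    (∃ g : D.H ≃ₐ[ℚ] D.H, g D.im = D.im ∧ g (D.sqrtNeg n) = D.sqrtNeg n ∧ D.galPt (g * g) (D.P n) ≠ D.P n) ↔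
      ∃ g : D.H ≃ₐ[ℚ] D.H, g D.im = D.im ∧ g (D.sqrtNeg n) = D.sqrtNeg n ∧ D.galPt g Q₁ ≠ Q₁ := by
  constructor
  · rintro ⟨g, hgi, hgK, hne⟩
    exact ⟨g, hgi, hgK, (galPt_sq_genusPoint_ne_iff_galPt_half_ne_of_odd_scriptL hsq hodd hr1 D h35 h318 hLodd hR hQ₁ g hgi hgK).mp hne⟩
  · rintro ⟨g, hgi, hgK, hne⟩
    exact ⟨g, hgi, hgK, (galPt_sq_genusPoint_ne_iff_galPt_half_ne_of_odd_scriptL hsq hodd hr1 D h35 h318 hLodd hR hQ₁ g hgi hgK).mpr hne⟩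

/-- **`𝓛(n)` ODD AND `x(R) ∉ {±1, ±n}·ℚ^{×2}` ⟹ A SQUARE-MOVER EXISTS IN THE STABILISER OF `i, √−n`** (square-free odd `n`, rank `≤ 1`, Thm 3.5, Lemma
3.18; `R = (x, y)` a generator of `E_n(ℚ)` mod torsion).  (Half-mover from `…HalfMover`, transported by the identity.)
[cite: TianYuanZhang2017, Thm. 3.5 (p0011 L94–L100), Lemma 3.18 (p0017 L152–L153), §1 (p0002 L101–L110)] [cite: SilvermanAEC2009, X.4.9] -/
theorem exists_sq_mover_of_odd_scriptL_of_x_not_mem (hsq : Squarefree n) [(congruentNumberCurve n).IsElliptic]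
    (hodd : Odd n) (hr1 : (congruentNumberCurve n).mordellWeilRank ≤ 1) (D : GenusPointData n) (h35 : D.thm35Main)
    (h318 : D.lemma318) (hLodd : Odd (D.scriptL n))
    {x y : ℚ} (hxy : (congruentNumberCurve n).toAffine.Nonsingular x y)
    (hR : ∀ P, ∃ k : ℤ, IsOfFinAddOrder (P - k • (Point.some x y hxy : (congruentNumberCurve n).toAffine.Point)))
    (hx : ¬ ∃ q : ℚ, x = q ^ 2 ∨ x = -q ^ 2 ∨ x = n * q ^ 2 ∨ x = -(n * q ^ 2)) :
    ∃ g : D.H ≃ₐ[ℚ] D.H, g D.im = D.im ∧ g (D.sqrtNeg n) = D.sqrtNeg n ∧ D.galPt (g * g) (D.P n) ≠ D.P n := by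
  have hn : n ∈ n.divisors := Nat.mem_divisors_self n hsq.ne_zero
  obtain ⟨Q₁, hQ₁⟩ := twist_halving hsq hn D (.some x y hxy)
  rw [exists_sq_mover_iff_exists_halfMover_of_odd_scriptL hsq hodd hr1 D h35 h318 hLodd hR hQ₁]
  exact exists_halfMover_of_x_not_mem hsq D hxy hx hQ₁

/-- **`𝓛(n)` ODD AND `ρ(n) = 0` ⟹ NO SQUARE OF THE STABILISER OF `i, √−n` MOVES `P(n)`** (square-free odd `n`, rank `≤ 1`, Thm 3.5, Lemma 3.18,
`[E_n(ℚ) : φ_n(A_n(ℚ)) + E_n[2]] = 1`): so Tian–Yuan–Zhang's mover at `s = 1`, where it exists, flips `i` on this stratum.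
[cite: TianYuanZhang2017, Thm. 3.5 (p0011 L94–L100), Lemma 3.18 (p0017 L152–L153), §1 (p0002 L101–L110)] -/
theorem galPt_sq_genusPoint_eq_of_odd_scriptL_of_rhoIndex_eq_one (hsq : Squarefree n) [(congruentNumberCurve n).IsElliptic]
    (hodd : Odd n) (hr1 : (congruentNumberCurve n).mordellWeilRank ≤ 1) (D : GenusPointData n) (h35 : D.thm35Main)
    (h318 : D.lemma318) (hLodd : Odd (D.scriptL n)) (hρ0 : (rhoSubgroup n).index = 1)
    (g : D.H ≃ₐ[ℚ] D.H) (hgi : g D.im = D.im) (hgK : g (D.sqrtNeg n) = D.sqrtNeg n) :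
    D.galPt (g * g) (D.P n) = D.P n := by
  have hn : n ∈ n.divisors := Nat.mem_divisors_self n hsq.ne_zero
  obtain ⟨R, hR⟩ := stub_S0 (n := n) hr1
  obtain ⟨Q₁, hQ₁⟩ := twist_halving hsq hn D R
  have hQ : D.galPt g Q₁ = Q₁ := galPt_half_eq_of_rhoIndex_eq_one hsq hodd hr1 D h318 hρ0 hR hQ₁ g hgi hgK
  by_contra hne
  exact ((galPt_sq_genusPoint_ne_iff_galPt_half_ne_of_odd_scriptL hsq hodd hr1 D h35 h318 hLodd hR hQ₁ g hgi hgK).mp hne) hQ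

end Summit.BirchSwinnertonDyer.PrintCf2.SquareMoverRho

end
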